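import Mathlib
import Literature.NumberTheory.Transcendental.LinEDS
import Literature.NumberTheory.Transcendental.LinEDSCode
import Literature.NumberTheory.Transcendental.LinEDSGroups
import Summits.KontsevichZagierPeriods.KontsevichZagierPeriods.Theorems.FurushoPentagonKernelModuloPeriodConjectureLeafOfCheckBlocks
import Summits.KontsevichZagierPeriods.KontsevichZagierPeriods.Theorems.FurushoPentagonKernelModuloPeriodConjectureXorRowsParity
import Summits.KontsevichZagierPeriods.KontsevichZagierPeriods.Theorems.FurushoPentagonKernelModuloPeriodConjectureLeafOfOddDetSum
import HarnessLib

/-!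
# `KernelModuloPeriodConjecture`, line `Sketch`: the leaf from a chain of GROUPED block certificates

Crux `FurushoPentagon.KernelModuloPeriodConjecture` (stmt-KontsevichZagierPeriods-15058), line
`Sketch`, lead c6. Block master theorem of the GF(2) rank engine for block certificates whose rows
are GROUPS of extended-double-shuffle row names (`LinEDS.checkBlockG`,
`Literature/NumberTheory/Transcendental/LinEDSGroups.lean`): the row of a group is the XOR of the
rows of its members, the mod-2 shadow of the SUM of their integer rows, again a valid linear
relation at every group-like pentagon solution. Needed in weight 15, where the plain rows supported
in depth `≤ 5` are rank-deficient by `64` mod 2 (the cusp defect of the depth filtration) while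
short integer combinations of plain rows with cancelling higher-depth parts close the gap, so that
the seven depth blocks `(0,5], (5,6], (6,7], (7,8], (8,9], (9,10], (10,14]` (at most `1716` columns
each) replace the unreachable first closed prefix `(0,7]` (`4068` columns). The proof is the c5
block master `stub_leaf_of_checkBlocks` with groups in place of names: block-lower-triangular mod 2
(`stub_blockDet_odd`), each diagonal block odd by E6 `stub_elimLoop_sound` + E7
`stub_oddDet_and_solve` + the group parity `stub_xorRows_parity`, then `stub_leaf_of_oddDetSum`.
Plain certificates (`LinEDS.checkBlock`) are grouped ones with singleton groups
(`LinEDS.checkBlockG_singletons`), so one master serves mixed chains (`leaf_of_checkBlocks_mixed`).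

References: K. Ihara, M. Kaneko, D. Zagier, Compos. Math. 142 (2006) §2, Conjecture 1
[IharaKanekoZagier2006]; F. Brown, Ann. of Math. 175 (2012) Thm 1.1 [Brown2012].
-/

namespace Summit.KontsevichZagierPeriods.FurushoPentagon.KernelModuloPeriodConjecture

open Literature.NumberTheory.Transcendental
open Literature.NumberTheory.Transcendental.LinEDS

/-! ### Group rows: parity and the unpacked check -/

/-- `xorAll` is the right fold of `^^^`. [folklore] -/
theorem blocksG_xorAll_eq_foldr : ∀ L : List ℕ, LinEDS.xorAll L = L.foldr (fun a b => a ^^^ b) 0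
  | [] => rfl
  | r :: rs => by rw [LinEDS.xorAll, List.foldr_cons, blocksG_xorAll_eq_foldr rs]

/-- **Parity of a group row**: at a column, the bit of the XOR of the member rows is the parity
of the sum of the member entries (worker stub G1, repackaged for `rowBitsG`/`entryG`).
[cite: IharaKanekoZagier2006, §2] -/
theorem blocksG_rowBitsG_parity {k : ℕ} {g : List (List ℕ × List ℕ)}
    (hval : ∀ μ ∈ g, LinEDS.validName k μ = true) {c : ℕ} (hc : c ∈ LinEDS.cols k) :
    (LinEDS.rowBitsG k g).testBit c = true ↔ Odd (LinEDS.entryG k g c) := by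
  rw [LinEDS.rowBitsG, blocksG_xorAll_eq_foldr]
  exact stub_xorRows_parity k g hval c hc

/-- Unpacking a successful `checkBlockG`. [folklore] -/
theorem blocksG_checkBlockG {k lo D : ℕ} {groups : List (List (List ℕ × List ℕ))}
    (h : LinEDS.checkBlockG k lo D groups = true) :
    groups.length = (LinEDS.colsDepth k lo D).length ∧
      (∀ g ∈ groups, ∀ μ ∈ g, LinEDS.validName k μ = true) ∧
      (∀ g ∈ groups, LinEDS.rowBitsG k g &&& LinEDS.maskOf (LinEDS.colsDepth k D k) = 0) ∧
      LinEDS.elimLoop (2 ^ (k - 1)) (LinEDS.rep (2 ^ (k - 1)) groups.length) (LinEDS.colsDepth k lo D)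
        (LinEDS.pack (2 ^ (k - 1))
          ((groups.map (LinEDS.rowBitsG k)).map (· &&& LinEDS.maskOf (LinEDS.colsDepth k lo D)))) = true := by
  simp only [LinEDS.checkBlockG, Bool.and_eq_true, List.all_eq_true, List.mem_map,
    forall_exists_index, and_imp, forall_apply_eq_imp_iff₂, beq_iff_eq] at h
  obtain ⟨⟨⟨hlen, hval⟩, hno⟩, helim⟩ := h
  rw [sameLength_eq_true_iff] at hlen
  rw [LinEDS.lengthTR_eq] at helim
  exact ⟨hlen, hval, hno, helim⟩

/-- **The diagonal block of a grouped certificate is odd**: the integer matrix of its groups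
against its own columns has odd determinant (E6 on the masked group rows, group parities, E7 (a)).
[cite: IharaKanekoZagier2006, §2] -/
theorem blocksG_diag_odd {k lo D : ℕ} (hk : 2 ≤ k) {groups : List (List (List ℕ × List ℕ))}
    (h : LinEDS.checkBlockG k lo D groups = true)
    (hlen : (LinEDS.colsDepth k lo D).length = groups.length) :
    Odd (Matrix.of fun (x y : Fin (LinEDS.colsDepth k lo D).length) =>
      LinEDS.entryG k (groups.get (Fin.cast hlen x)) ((LinEDS.colsDepth k lo D).get y)).det := by
  classical
  obtain ⟨-, hval, -, helim⟩ := blocksG_checkBlockG h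
  obtain ⟨hpw, hcols, -, -⟩ := stub_cols_spec k hk
  set C := LinEDS.colsDepth k lo D with hC
  set mask := LinEDS.maskOf C with hmask
  have hCsub : ∀ c ∈ C, c ∈ LinEDS.cols k := fun c hc => (blocksE13_mem_colsDepth.mp hc).1
  have hCpw : C.Pairwise (· < ·) := by rw [hC, LinEDS.colsDepth]; exact hpw.filter _
  set rows := (groups.map (LinEDS.rowBitsG k)).map (· &&& mask) with hrows
  have hW : 0 < 2 ^ (k - 1) := by positivity
  have hmasklt : mask < 2 ^ 2 ^ (k - 1) := by
    refine Nat.lt_pow_two_of_testBit _ fun i hi => ?_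
    cases hb : mask.testBit i
    · rfl
    · have := ((hcols i).mp (hCsub i ((blocksE13_testBit_maskOf C i).mp hb))).1; omega
  have hrowlt : ∀ r ∈ rows, r < 2 ^ 2 ^ (k - 1) := by
    intro r hr
    obtain ⟨r', -, rfl⟩ := List.mem_map.mp hr
    exact lt_of_le_of_lt Nat.and_le_right hmasklt
  have hrowslen : rows.length = groups.length := by simp [hrows]
  have hpiv := stub_elimLoop_sound (2 ^ (k - 1)) rows C hW hrowlt
    (fun c hc => ((hcols c).mp (hCsub c hc)).1) (by rw [hrowslen]; exact helim)
  let row : Fin C.length → ℕ := fun x => LinEDS.rowBitsG k (groups.get (Fin.cast hlen x)) &&& mask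
  have hofFn : List.ofFn row = rows := by
    rw [hrows, List.map_map]
    exact blocksE13_ofFn_get groups ((· &&& mask) ∘ LinEDS.rowBitsG k) hlen
  have hmono : StrictMono C.get := fun x y hxy => List.pairwise_iff_get.mp hCpw x y hxy
  refine stub_oddDet_and_solve.1 C.length row C.get hmono
    (fun y => hofFn ▸ hpiv (C.get y) (List.get_mem _ _)) _ fun x y => ?_
  have hy : C.get y ∈ C := List.get_mem _ _
  rw [Matrix.of_apply, ← blocksG_rowBitsG_parity (hval _ (List.get_mem _ _)) (hCsub _ hy)]
  show _ ↔ (LinEDS.rowBitsG k (groups.get (Fin.cast hlen x)) &&& mask).testBit (C.get y) = true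
  rw [Nat.testBit_land, (blocksE13_testBit_maskOf C _).mpr hy, Bool.and_true]

/-! ### The registered stub -/

/-- **The leaf from a chain of grouped block certificates** (registered stub
`stub_leaf_of_checkBlocksG`, lead c6; crux stmt-KontsevichZagierPeriods-15058, line `Sketch`):
consecutive depth blocks `(0, D₁], (D₁, D₂], …` covering every column, each certified by
`LinEDS.checkBlockG` ⇒ the weight-`k` slice of the algebraic leaf. [cite: IharaKanekoZagier2006, Conjecture 1] -/
theorem stub_leaf_of_checkBlocksG :
    ∀ (k : ℕ) (bl : List (ℕ × ℕ)), 2 ≤ k → bl ≠ [] → (∀ p ∈ bl, p.1 ≤ p.2) →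
      bl.head?.map Prod.fst = some 0 → bl.IsChain (fun p q => p.2 = q.1) →
      (∀ p ∈ bl, ∃ groups, LinEDS.checkBlockG k p.1 p.2 groups = true) →
      LinEDS.depthCovered k ((bl.getLast?.map Prod.snd).getD 0) = true →
      ∀ s : List ℕ, MZV.IsAdmissible s → MZV.weight s = k →
        ∃ b : List ℕ →₀ ℚ, (∀ t ∈ b.support, MZV.IsHoffman t ∧ MZV.weight t = MZV.weight s) ∧ ∀ (R : Type) [CommRing R] [Algebra ℚ R] [IsReduced R] (φ : NCSeries Bool R), NCSeries.IsGroupLike φ → NCSeries.DrinfeldPentagon φ → φ (MZV.binaryWord s) = b.sum (fun t q => q • φ (MZV.binaryWord t)) := by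
  classical
  intro k bl hk hne hle hhead hchain hblocks hcov s hs hw
  choose nm hnm using hblocks
  set B := bl.length with hB
  let lo : Fin B → ℕ := fun β => (bl.get β).1
  let Dp : Fin B → ℕ := fun β => (bl.get β).2
  let groups : Fin B → List (List (List ℕ × List ℕ)) := fun β => nm (bl.get β) (List.get_mem _ _)
  have hchk : ∀ β, LinEDS.checkBlockG k (lo β) (Dp β) (groups β) = true := fun β => hnm _ _
  let C : Fin B → List ℕ := fun β => LinEDS.colsDepth k (lo β) (Dp β)
  let nb : Fin B → ℕ := fun β => (C β).length
  have hlen : ∀ β, (C β).length = (groups β).length :=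
    fun β => ((blocksG_checkBlockG (hchk β)).1).symm
  -- positions, groups and columns
  let ν : (Σ β : Fin B, Fin (nb β)) → List (List ℕ × List ℕ) :=
    fun i => (groups i.1).get (Fin.cast (hlen i.1) i.2)
  let col : (Σ β : Fin B, Fin (nb β)) → ℕ := fun j => (C j.1).get j.2
  have hvalid : ∀ i, ∀ μ ∈ ν i, LinEDS.validName k μ = true :=
    fun i => (blocksG_checkBlockG (hchk i.1)).2.1 _ (List.get_mem _ _)
  have hcolC : ∀ j, col j ∈ C j.1 := fun j => List.get_mem _ _
  have hcolmem : ∀ j, col j ∈ LinEDS.cols k := fun j => (blocksE13_mem_colsDepth.mp (hcolC j)).1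
  obtain ⟨-, hcols, -, -⟩ := stub_cols_spec k hk
  -- every column lies in a block
  have hhead' : (bl.head hne).1 = 0 := by
    rw [List.head?_eq_some_head hne] at hhead
    simpa using hhead
  have hlast' : (bl.getLast?.map Prod.snd).getD 0 = (bl.getLast hne).2 := by
    rw [List.getLast?_eq_some_getLast hne]; rfl
  rw [hlast'] at hcov
  have hcolsurj : ∀ c ∈ LinEDS.cols k, ∃ j, col j = c := by
    intro c hc
    have hd1 : 1 ≤ LinEDS.popc k c := blocksE13_popc_pos (by omega) ((hcols c).mp hc).2.1
    have hd2 : LinEDS.popc k c ≤ (bl.getLast hne).2 := by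
      simp only [LinEDS.depthCovered, List.all_eq_true, Nat.ble_eq] at hcov
      exact hcov c hc
    obtain ⟨β, h1, h2⟩ := blocksE13_chain_cover bl hne hchain (LinEDS.popc k c) (by omega) hd2
    have hcC : c ∈ C β := blocksE13_mem_colsDepth.mpr ⟨hc, h1, h2⟩
    obtain ⟨y, hy⟩ := List.mem_iff_get.mp hcC
    exact ⟨⟨β, y⟩, hy⟩
  -- odd determinant, by blocks
  have hdet : Odd (Matrix.of fun i j => LinEDS.entryG k (ν i) (col j)).det := by
    refine stub_blockDet_odd B nb _ (fun i j hij => ?_) (fun β => ?_)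
    · -- above the diagonal blocks the bit vanishes, so the group entry is even
      rw [Matrix.of_apply, ← Int.not_odd_iff_even,
        ← blocksG_rowBitsG_parity (hvalid i) (hcolmem j)]
      have hdepth : Dp i.1 < LinEDS.popc k (col j) :=
        lt_of_le_of_lt (blocksE13_chain_mono bl hchain hle i.1 j.1 hij)
          (blocksE13_mem_colsDepth.mp (hcolC j)).2.1
      have hhigher : col j ∈ LinEDS.colsDepth k (Dp i.1) k :=
        blocksE13_mem_colsDepth.mpr ⟨hcolmem j, hdepth, blocksE13_popc_le _ _⟩
      have hzero := (blocksG_checkBlockG (hchk i.1)).2.2.1 _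
        (List.get_mem _ (Fin.cast (hlen i.1) i.2))
      have hbit := congrArg (·.testBit (col j)) hzero
      simp only [Nat.testBit_land, Nat.zero_testBit,
        (blocksE13_testBit_maskOf _ _).mpr hhigher, Bool.and_true] at hbit
      show ¬ (LinEDS.rowBitsG k (ν i)).testBit (col j) = true
      rw [hbit]; exact Bool.false_ne_true
    · exact blocksG_diag_odd hk (hchk β) (hlen β)
  exact stub_leaf_of_oddDetSum k _ ν col hk hvalid hcolmem hcolsurj hdet s hs hw

/-- **Mixed chains**: every block certified EITHER by the plain check `LinEDS.checkBlock` OR by the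
grouped check `LinEDS.checkBlockG` ⇒ the weight-`k` slice of the leaf (plain certificates are
grouped ones with singleton groups, `LinEDS.checkBlockG_singletons`). [cite: IharaKanekoZagier2006, Conjecture 1] -/
theorem leaf_of_checkBlocks_mixed (k : ℕ) (bl : List (ℕ × ℕ)) (hk : 2 ≤ k) (hne : bl ≠ [])
    (hle : ∀ p ∈ bl, p.1 ≤ p.2) (hhead : bl.head?.map Prod.fst = some 0)
    (hchain : bl.IsChain (fun p q => p.2 = q.1))
    (hblocks : ∀ p ∈ bl, (∃ names, LinEDS.checkBlock k p.1 p.2 names = true) ∨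
      (∃ groups, LinEDS.checkBlockG k p.1 p.2 groups = true))
    (hcov : LinEDS.depthCovered k ((bl.getLast?.map Prod.snd).getD 0) = true)
    (s : List ℕ) (hs : MZV.IsAdmissible s) (hw : MZV.weight s = k) :
    ∃ b : List ℕ →₀ ℚ, (∀ t ∈ b.support, MZV.IsHoffman t ∧ MZV.weight t = MZV.weight s) ∧ ∀ (R : Type) [CommRing R] [Algebra ℚ R] [IsReduced R] (φ : NCSeries Bool R), NCSeries.IsGroupLike φ → NCSeries.DrinfeldPentagon φ → φ (MZV.binaryWord s) = b.sum (fun t q => q • φ (MZV.binaryWord t)) := by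
  refine stub_leaf_of_checkBlocksG k bl hk hne hle hhead hchain (fun p hp => ?_) hcov s hs hw
  rcases hblocks p hp with ⟨names, h⟩ | h
  · exact ⟨names.map fun ν => [ν], by rw [LinEDS.checkBlockG_singletons]; exact h⟩
  · exact h

end Summit.KontsevichZagierPeriods.FurushoPentagon.KernelModuloPeriodConjecture
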